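import Summits.Parity.GeneralizedHardyLittlewood.Theorems.LeeYangFibresRelativeDimOneMoebiusSplitDefs
import Summits.Parity.GeneralizedHardyLittlewood.Theorems.LeeYangFibresAbsoluteUpgradeSlices
import Summits.Parity.GeneralizedHardyLittlewood.Theorems.LeeYangFibresRelativeDimOneFloatingCalibrationFree
import HarnessLib

/-!
# Crux `RelativeDimOne` (stmt-Parity-14113), live line `single-moebius-split` — NEGATION LENS (crux-strategist s1):
# the atom `H` inherits the node's Siegel-sensitivity

Kernel-checked, modulo NOTHING but the line's own provable stubs taken as hypotheses (T1 = all-truncated main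
term, T0' = pure-Möbius term, S1 = term bound from the atom, S2 = assembly), all over the landed vocabulary
`Theorems.LeeYangFibresRelativeDimOneMoebiusSplitDefs`:

* `relativeDimOne_of_stubs` — the skeleton's composition in hypothesis form (copy of `RelativeDimOne_of` of
  `Cruxes/RelativeDimOne/Lines/single_moebius_split.lean` with T1 unsplit), real proof;
* `noSiegelZeros_of_hybrid` — **T1 → T0' → S1 → S2 → H → NoSiegelZeros**: once the provable stubs land, ANY proof of
  the atom `H = ∀ s ≥ 1, ∃ η > 0, ∀ C A, HybridOneMoebius s η C A` proves rh.S34 (no Siegel zeros of unbounded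
  quality is even refuting: `not_hybrid_of_unboundedSiegelZeros`). Source of the necessity: the debt-free
  `noSiegelZeros_of_relativeDimOne'` (Tao–Teräväinen 2021 Prop. 3.5 + `uniformCharPNT_of_relativeDimOne`, p92834).

Reading (census §Negation): the atom is not "merely Chowla-type". Tao–Teräväinen (JLMS 2022) prove the FIXED-shift,
undilated hybrid correlations `∑ Λ(n)λ(n+h)` DO cancel on Siegel scales, so the Siegel content of `H` sits in its
UNIFORMITY — the polynomially dilated prime forms (`∀ C`) and shifts tied to the exceptional modulus — which is exactly
the regime `C ≥ C(δ) ≈ (1 − δ_j)/δ_j` that stub S1 (`stub_termClassSums`) consumes (short Möbius variable `d ≤ N^{1/2}`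
against prime `j`-tuples in progressions of modulus `d`: signed "Bombieri–Vinogradov for prime tuples" in disguise).
-/

noncomputable section

namespace Summit.Parity.GeneralizedHardyLittlewood.Cruxes.RelativeDimOne.SingleMoebiusSplit

open Literature.Barriers.Parity (UnboundedSiegelZeros)
open Literature.NumberTheory.LFunctions (NoSiegelZeros)
open Summit.Parity.GeneralizedHardyLittlewood.Theses.LeeYangFibres (RelativeDimOne)
open Summit.Parity.GeneralizedHardyLittlewood.Cruxes.RelativeDimOne.FloatingLevelCore
  (noSiegelZeros_of_relativeDimOne' not_relativeDimOne_of_unboundedSiegelZeros')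

/-- The line's provable part, bundled: T1 (all-truncated main term), T0' (pure-Möbius term), S1 (term `j ≥ 1`
from the atom `H_j`), S2 (telescoping assembly) — each the statement of a registered/landed stub of
`Lines/single_moebius_split.lean` (T1 = `truncatedMainTerm_of stub_truncLatticeCount truncSingularSeries_of`,
T0' = `stub_moebiusTermBV`, S1 = `termBound_of`, S2 = `stub_assembly`, landed p138577). -/
def ProvablePart : Prop :=
  (∀ k : ℕ, TruncatedMainTerm (k + 1)) ∧
  (∀ k : ℕ, MoebiusTermBound k) ∧
  (∀ (k : ℕ) (j : Fin (k + 1)), j ≠ 0 → ∀ η : ℝ, 0 < η →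
      (∀ C A : ℝ, HybridOneMoebius (j : ℕ) η C A) → TermBound k j η) ∧
  (∀ k : ℕ, TruncatedMainTerm (k + 1) → MoebiusTermBound k →
      (∀ j : Fin (k + 1), j ≠ 0 → ∃ η : ℝ, 0 < η ∧ TermBound k j η) → RelDimOneSlice (k + 1))

/-- The atom of the line: the single-Möbius hybrid Hardy–Littlewood–Chowla schema (`stub_hybrid`, verbatim). -/
def Hybrid : Prop :=
  ∀ s : ℕ, 1 ≤ s → ∃ η : ℝ, 0 < η ∧ ∀ C A : ℝ, HybridOneMoebius s η C A

/-- The skeleton's composition in hypothesis form (real proof; `t = k + 1`, the assembly fed with T1, T0' and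
S1 at the atom's `η_j`). -/
theorem relativeDimOne_of_stubs (hP : ProvablePart) (hH : Hybrid) : RelativeDimOne := by
  obtain ⟨hT1, hT0, hS1, hS2⟩ := hP
  intro t L ht ε hε
  obtain ⟨k, rfl⟩ : ∃ k, t = k + 1 := ⟨t - 1, by omega⟩
  revert L ε hε
  refine hS2 k (hT1 k) (hT0 k) fun j hj => ?_
  have hj1 : 1 ≤ (j : ℕ) := Nat.one_le_iff_ne_zero.mpr fun h => hj (Fin.ext h)
  obtain ⟨η, hη, hHj⟩ := hH (j : ℕ) hj1
  exact ⟨η, hη, hS1 k j hj η hη hHj⟩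

/-- **NEGATION LENS, typed**: given the provable part, the atom proves rh.S34 —
`ProvablePart → Hybrid → NoSiegelZeros`. Any proof of `stub_hybrid` must therefore, somewhere, exclude Siegel
zeros of unbounded quality; no Siegel-blind (pretentious / entropy-decrement / Matomäki–Radziwiłł) argument can
prove the atom as registered. -/
theorem noSiegelZeros_of_hybrid (hP : ProvablePart) (hH : Hybrid) : NoSiegelZeros :=
  noSiegelZeros_of_relativeDimOne' (relativeDimOne_of_stubs hP hH)

/-- Equivalently: in the illusory world (Siegel zeros of unbounded quality) the atom is FALSE as soon as the
provable stubs are theorems — the refuting instance then lives in the dilated regime (`∀ C`), cf. the module doc. -/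
theorem not_hybrid_of_unboundedSiegelZeros (hU : UnboundedSiegelZeros) (hP : ProvablePart) : ¬ Hybrid :=
  fun hH => not_relativeDimOne_of_unboundedSiegelZeros' hU (relativeDimOne_of_stubs hP hH)

end Summit.Parity.GeneralizedHardyLittlewood.Cruxes.RelativeDimOne.SingleMoebiusSplit
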